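import Mathlib
import Literature.Probability.LatticeModels.ThermodynamicLimit
import Literature.Probability.LatticeModels.SharpnessProofs
import Summits.CriticalPhenomena.Ising3DConformalLimit.Theorems.PrecisionLaplacianDirectCorrelationStableTailSymbolIdentificationAux2
import HarnessLib

/-!
# Stub `stub_symbolIdentification` of line `diffusive-branch-is-nonsaturation` (crux
# `PrecisionLaplacian.DirectCorrelationStableTail`, stmt-CriticalPhenomena-4799): identification of the rescaled
# Lévy–Khintchine symbol of the precision row

Lead prover-line-stmt-CriticalPhenomena-4799-c4-0 (2026-08-17).  Pure theorem file (no definitions, no `sorry`).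

**Statement** (registered text, = `stub_symbolIdentification` of the lead's skeleton rev c4-1).  Let `m ∈ ℓ¹(ℤ³)` be the
precision row of a kernel `0 ≤ G ≤ 1` (even): `Σ m = 0`, `m ≥ 0` off `0`, `Σ_y m(y)G(z − y) = −δ_{z0}`, `1 < α < 2`,
`c > 0`.  Assume tightness at infinity and at zero (conclusions of `stub_tightness`), the scale identity
(`stub_scaleIdentity`, verbatim), the kernel estimate at scale (`stub_kernelScaling`, for this `G, α, c`) and the
Riesz–Gaussian asymptotics (`stub_rieszGaussian`, for this `α`).  Then with `c' = 1/(c C_α)`, for every `k ∈ ℝ³`,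
`R^α Σ_y m(y)(1 − cos(k·y/R)) → c' |k|₂^α` as `R → ∞`.

**Proof.**  For `k = 0` both sides vanish.  For `k ≠ 0`, `Λ := C_α|k|₂^{-α} > 0` and the registered sub-goal
`stub_symbolIdentification_auxCore` (file `…SymbolIdentificationAux2.lean`) gives `|cΛ ψ_R − 1| ≤ δ` for large `R`;
since `|ψ_R − (cΛ)⁻¹| = |cΛψ_R − 1|/(cΛ)` and `(cC_α)⁻¹|k|^α = (cΛ)⁻¹`, the convergence follows.

This is the identification step of the converse two-point spine: with `stub_levyContinuityTransfer` it turns the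
isotropic pure power law of the critical two-point function (item 0634) into the stable Lévy scaling of the critical
direct correlation function, hence the crux.  References: folklore (the argument is a measure-level Tauberian theorem
organised around the precision identity; no Ising input beyond the hypotheses).
-/

noncomputable section

namespace Summit.CriticalPhenomena.Ising3DConformalLimit.Cruxes.DirectCorrelationStableTail.DiffusiveBranchIsNonsaturation

open MeasureTheory Filter Topology
open scoped BigOperators
open Literature.Probability.LatticeModels

/-! ### The registered stub -/

/-- The Euclidean norm of a nonzero momentum is positive. [folklore] -/
theorem symId_sqrt_sum_sq_pos {k : Fin 3 → ℝ} (hk : k ≠ 0) : 0 < Real.sqrt (∑ i, k i ^ 2) := by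
  refine Real.sqrt_pos.2 ?_
  obtain ⟨i, hi⟩ : ∃ i, k i ≠ 0 := by
    by_contra h
    push Not at h
    exact hk (funext h)
  exact lt_of_lt_of_le (by positivity : 0 < k i ^ 2)
    (Finset.single_le_sum (f := fun j => k j ^ 2) (fun j _ => sq_nonneg _) (Finset.mem_univ i))

/-- **Stub S5 `stub_symbolIdentification` (registered signature, verbatim): identification of the rescaled symbol.**
With the tightness data of S1, the scale identity S2 (verbatim, as a hypothesis), the kernel estimate S3 and the
Riesz–Gaussian asymptotics S4 (their conclusions for this `G`, `α`, `c`), the rescaled Lévy–Khintchine symbol of the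
precision row converges to the isotropic stable symbol: `R^α Σ_y m(y)(1 − cos(k·y/R)) → |k|₂^α/(c C_α)`.  For `k ≠ 0`
this is `symId_core` (with `Λ = C_α|k|^{-α}`, `|ψ_R − (cΛ)⁻¹| = |cΛψ_R − 1|/(cΛ)`); for `k = 0` both sides vanish.
[folklore] -/
theorem stub_symbolIdentification :
    ∀ (m G : Site 3 → ℝ) (α c C C' : ℝ) (R₁ : ℕ),
      Summable m → (∑' y, m y) = 0 → (∀ y, y ≠ 0 → 0 ≤ m y) → (∀ y, m (-y) = m y) →
      (∀ x, 0 ≤ G x) → (∀ x, G x ≤ 1) → (∀ x, G (-x) = G x) →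
      (∀ z : Site 3, (∑' y, m y * G (z - y)) = if z = 0 then -1 else 0) →
      1 < α → α < 2 → 0 < c →
      (∀ R : ℕ, R₁ ≤ R → ∀ T : Finset (Site 3), (∀ y ∈ T, (R : ℝ) ≤ ‖y‖) → (R : ℝ) ^ α * ∑ y ∈ T, m y ≤ C) →
      (∀ R : ℕ, 1 ≤ R → ∑ y ∈ box 3 R, m y * (∑ i, ((y i : ℝ)) ^ 2) ≤ C' * (R : ℝ) ^ (2 - α)) →
      (∀ (m G : Site 3 → ℝ) (φ : (Fin 3 → ℝ) → ℝ) (R : ℝ) (Ψ : Site 3 → ℝ),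
        Summable m → (∑' y, m y) = 0 →
        (∀ x, 0 ≤ G x) → (∀ x, G x ≤ 1) → (∀ x, G (-x) = G x) →
        (∀ z : Site 3, (∑' y, m y * G (z - y)) = if z = 0 then -1 else 0) →
        (∀ v, φ (-v) = φ v) → (∀ v, |φ v| ≤ 1) → Summable (fun z : Site 3 => φ (fun i => (z i : ℝ) / R)) →
        (∀ y, Ψ y = ∑' z : Site 3, φ (fun i => (z i : ℝ) / R) * G (z - y)) →
        Summable (fun y => m y * (Ψ 0 - Ψ y)) ∧ (∑' y, m y * (Ψ 0 - Ψ y)) = φ 0 ∧ (∀ y, Ψ (-y) = Ψ y)) →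
      (∀ (t : ℝ) (k : Fin 3 → ℝ), 0 < t →
        (∀ R : ℕ, 1 ≤ R → Summable (fun z : Site 3 =>
          Real.exp (-(t * ∑ i, ((z i : ℝ) / R) ^ 2)) * Real.cos (∑ i, k i * ((z i : ℝ) / R)))) ∧
        ∀ ε : ℝ, 0 < ε → ∃ R₀ : ℕ, ∀ R : ℕ, R₀ ≤ R → ∀ (Ψ : Site 3 → ℝ) (D : (Fin 3 → ℝ) → ℝ),
          (∀ y, Ψ y = ∑' z : Site 3,
            (Real.exp (-(t * ∑ i, ((z i : ℝ) / R) ^ 2)) * Real.cos (∑ i, k i * ((z i : ℝ) / R))) * G (z - y)) →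
          (∀ u, D u = ∫ v : Fin 3 → ℝ, Real.sqrt (∑ i, v i ^ 2) ^ (α - 3) *
            (Real.exp (-(t * ∑ i, v i ^ 2)) * Real.cos (∑ i, k i * v i) -
              Real.exp (-(t * ∑ i, (v i + u i) ^ 2)) * Real.cos (∑ i, k i * (v i + u i)))) →
          ∀ y : Site 3, |(R : ℝ) ^ (-α) * (Ψ 0 - Ψ y) - c * D (fun i => (y i : ℝ) / R)| ≤
            ε * min (∑ i, ((y i : ℝ) / R) ^ 2) 1) →
      (∃ Cα : ℝ, 0 < Cα ∧ ∀ k : Fin 3 → ℝ, k ≠ 0 → ∃ B : ℝ, 0 ≤ B ∧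
        ∀ ε : ℝ, 0 < ε → ∃ t₀ : ℝ, 0 < t₀ ∧ ∀ t : ℝ, 0 < t → t < t₀ → ∀ D : (Fin 3 → ℝ) → ℝ,
          (∀ u, D u = ∫ v : Fin 3 → ℝ, Real.sqrt (∑ i, v i ^ 2) ^ (α - 3) *
            (Real.exp (-(t * ∑ i, v i ^ 2)) * Real.cos (∑ i, k i * v i) -
              Real.exp (-(t * ∑ i, (v i + u i) ^ 2)) * Real.cos (∑ i, k i * (v i + u i)))) →
          (∀ u : Fin 3 → ℝ, Real.sqrt (∑ i, u i ^ 2) ≤ t ^ (-(1 / 4 : ℝ)) →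
            |D u - Cα * Real.sqrt (∑ i, k i ^ 2) ^ (-α) * (1 - Real.cos (∑ i, k i * u i))| ≤ ε) ∧
          (∀ u : Fin 3 → ℝ, Real.sqrt (∑ i, u i ^ 2) ≤ 1 →
            |D u - Cα * Real.sqrt (∑ i, k i ^ 2) ^ (-α) * (1 - Real.cos (∑ i, k i * u i))| ≤ ε * ∑ i, u i ^ 2) ∧
          (∀ u : Fin 3 → ℝ, |D u| ≤ B)) →
      ∃ c' : ℝ, 0 < c' ∧ ∀ k : Fin 3 → ℝ,
        Filter.Tendsto (fun R : ℕ => (R : ℝ) ^ α * ∑' y : Site 3, m y * (1 - Real.cos (∑ i, k i * ((y i : ℝ) / R))))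
          Filter.atTop (nhds (c' * Real.sqrt (∑ i, k i ^ 2) ^ α)) := by
  intro m G α c C C' R₁ hsum hzero hnn _heven hG0 hG1 hGe hconv hα1 hα2 hc hinf hzer hS2 hS3 hS4
  obtain ⟨Cα, hCα, hS4⟩ := hS4
  refine ⟨(c * Cα)⁻¹, by positivity, fun k => ?_⟩
  by_cases hk : k = 0
  · -- `k = 0`: both sides vanish
    subst hk
    have hfun : (fun R : ℕ => (R : ℝ) ^ α * ∑' y : Site 3,
        m y * (1 - Real.cos (∑ i, (0 : Fin 3 → ℝ) i * ((y i : ℝ) / R)))) = fun _ => 0 := by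
      funext R
      simp
    have hval : (c * Cα)⁻¹ * Real.sqrt (∑ i, (0 : Fin 3 → ℝ) i ^ 2) ^ α = 0 := by
      have hα0 : α ≠ 0 := by linarith
      simp [Real.zero_rpow hα0]
    rw [hfun, hval]
    exact tendsto_const_nhds
  · -- `k ≠ 0`: the core estimate
    obtain ⟨B, hB, hS4k⟩ := hS4 k hk
    have hEpos := symId_sqrt_sum_sq_pos hk
    have hΛpos : 0 < Cα * Real.sqrt (∑ i, k i ^ 2) ^ (-α) := mul_pos hCα (Real.rpow_pos_of_pos hEpos _)
    have hcΛ : 0 < c * (Cα * Real.sqrt (∑ i, k i ^ 2) ^ (-α)) := mul_pos hc hΛpos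
    have hcore := symId_core hsum hzero hnn hG0 hG1 hGe hconv hα1 hα2 hc hCα hB hk hinf hzer hS2 hS3 hS4k
    have hval : (c * Cα)⁻¹ * Real.sqrt (∑ i, k i ^ 2) ^ α = (c * (Cα * Real.sqrt (∑ i, k i ^ 2) ^ (-α)))⁻¹ := by
      rw [Real.rpow_neg hEpos.le, mul_inv, mul_inv, mul_inv, inv_inv, mul_assoc]
    rw [hval, Metric.tendsto_atTop]
    intro ε hε
    obtain ⟨R₂, hR₂⟩ := hcore (ε / 2 * (c * (Cα * Real.sqrt (∑ i, k i ^ 2) ^ (-α)))) (by positivity)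
    refine ⟨R₂, fun R hR => ?_⟩
    have h := hR₂ R hR
    set ψ : ℝ := (R : ℝ) ^ α * ∑' y : Site 3, m y * (1 - Real.cos (∑ i, k i * ((y i : ℝ) / R))) with hψ
    set L : ℝ := c * (Cα * Real.sqrt (∑ i, k i ^ 2) ^ (-α)) with hL
    rw [Real.dist_eq]
    have key : |ψ - L⁻¹| = |L * ψ - 1| / L := by
      rw [eq_div_iff hcΛ.ne', ← abs_of_pos hcΛ, ← abs_mul, abs_of_pos hcΛ]
      congr 1
      field_simp
    rw [key, div_lt_iff₀ hcΛ]
    calc |L * ψ - 1| ≤ ε / 2 * L := h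
      _ < ε * L := by nlinarith

end Summit.CriticalPhenomena.Ising3DConformalLimit.Cruxes.DirectCorrelationStableTail.DiffusiveBranchIsNonsaturation

end
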